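import Summits.SmoothPoincare4.SmoothPoincare4.Theorems.NilpotentShadowsStandard.Negative.Shape
import Summits.SmoothPoincare4.SmoothPoincare4.Theorems.CongruenceShadowsNilpotentShadowsStandardStubJohnsonGenerators
import Summits.SmoothPoincare4.SmoothPoincare4.Theorems.CongruenceShadowsNilpotentShadowsStandardStubMagnusWittRead
import Summits.SmoothPoincare4.SmoothPoincare4.Theorems.CongruenceShadowsNilpotentShadowsStandardStubLevelOneGlue
import Summits.SmoothPoincare4.SmoothPoincare4.Theorems.CongruenceShadowsAbelianShadowStandard
import Summits.SmoothPoincare4.SmoothPoincare4.Theorems.CongruenceShadowsShadowsStandardStubAbelianLevels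
import Summits.SmoothPoincare4.SmoothPoincare4.Theorems.ShadowsStandard.Negative.ShadowLevels
import HarnessLib

/-!
# Stub `stub_classTwoLevels` of line `prym-layer-stable-rank` for crux `CongruenceShadows.ShadowsStandard`
(item stmt-SmoothPoincare4-14593, route route-SmoothPoincare4-CongruenceShadows): THE CLASS-TWO STRATUM

Registered signature (lead c2 reshape v2): for every `(3+3m; m+1)` group trisection `K` of the trivial
group and every CHARACTERISTIC `M ⊇ γ₃S` of `S = SurfaceGroup (3+3m)` some automorphism `ψ` of `S` has
`ψ(Nᵢ ⊔ M) = Kᵢ ⊔ M` for `i = 0,1,2` (`N = s4Kernels.stabilizeIter m`) — `stub_classTwoLevels` below. It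
supersedes `stub_abelianLevels` (levels `⊇ γ₂S`, p122685) as the base of the line's chief-layer descent and
discharges every chief layer whose lower level has nilpotency class `≤ 2` (originally assembled by a wave-1
worker as the central sub-case of `stub_wildAbelianDeepLayer`).

Let `S = SurfaceGroup (3 + 3m)`, `N = s4Kernels.stabilizeIter m`, `γₖ S` the lower central series
(`γ_{c+2} S = (⊤ : Subgroup S).lowerCentralSeries (c + 1)`), `K` a `(3+3m; m+1)` group trisection of
the trivial group.

* `nilpotentShadowsStandard_one` — **the `c = 1` rung of item 14594 `NilpotentShadowsStandard`, for
  every `m`**: some `ψ ∈ Aut S` has `ψ(Nᵢ·γ₃S) = Kᵢ·γ₃S` (`i = 0,1,2`). Assembled here from LANDED tree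
  theorems only: the base `abelianShadowStandard_proof` (item 14599), the level-one REACH
  `stub_levelOneGlue stub_johnsonGenerators stub_magnusWittRead` (Johnson 1980 Thm 1 in the presented
  surface group + Magnus–Witt reading + torsor gluing), and the dictionary inputs `stub_cutNormalForm`,
  `stub_noHiddenDepth`; the ≈60 lines of glue (`dictionary`, `step`) are adapted from the published
  lead skeleton `Cruxes/NilpotentShadowsStandard/Lines/saturated_torsor_descent.lean` (v7), where they
  are kernel-checked but live next to open stubs and so cannot be imported.
* `classTwoLevels` — hence EVERY characteristic level `M' ⊇ γ₃ S` (i.e. `S/M'` nilpotent of class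
  `≤ 2`, finite or not) is standard: `∃ ψ, ∀ i, ψ(Nᵢ·M') = Kᵢ·M'` (monotonicity
  `map_sup_eq_of_le_characteristic` from the landed `stub_abelianLevels` file).
* `stub_classTwoLevels` — the registered signature (= `classTwoLevels` in `∀`-form). In the line's
  descent it is the BASE: every level whose quotient has nilpotency class `≤ 2` (in particular the whole
  abelian stratum and every wild chief layer directly below `[S,S]·S^p`, which is central because
  `S/M'` is then a finite `p`-group — proved in the sibling helper file) is standard for all `m` at once.

What is NOT covered (and is not provable from the tree today): central layers with `S/M'` of class
`≥ 3` (= the rungs `c ≥ 2` of item 14594: `stub_reachTwo`, `stub_reachHigher` open), central layers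
under a NON-nilpotent `Q = S/M` (Schur-multiplier / `H²(Q;𝔽_p)` regime), and all non-central wild
layers (modular Prym representations of `Aut S[M]` at fixed genus).
-/

set_option linter.dupNamespace false

noncomputable section

namespace Summit.SmoothPoincare4.SmoothPoincare4.Theorems.ShadowsStandard.PrymLayerStableRank

open Literature.Topology.FourManifolds
open Subgroup
open scoped Pointwise commutatorElement

namespace WildCentral

/-- **REACH at level one, every `m`** (torsor coordinates of the 14594 skeleton: for an HONEST
kernel triple standard on the nose modulo `γ₂`, an automorphism stabilising the three level shadows
throws every cut letter of `Cᵢ` into `Kᵢ·γ₃`) — from the landed `stub_levelOneGlue`,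
`stub_johnsonGenerators`, `stub_magnusWittRead` (item 14594, line saturated-torsor-descent).
[cite: Johnson1980AbelianQuotient, Thm 1] -/
theorem reach_zero (m : ℕ) :
    ∀ K : TrisectionKernels (3 + 3 * m), (∀ i, (K i).Normal) →
    (∀ i, IsFreeOfRank (SurfaceGroup (3 + 3 * m) ⧸ normalClosure (K i : Set (SurfaceGroup (3 + 3 * m)))) (3 + 3 * m)) →
    (∀ i j : Fin 3, i ≠ j → IsFreeOfRank (K.pairQuotient i j) (m + 1)) →
    (∀ i, K i ⊔ (⊤ : Subgroup (SurfaceGroup (3 + 3 * m))).lowerCentralSeries (0 + 1) = s4Kernels.stabilizeIter m i ⊔ (⊤ : Subgroup (SurfaceGroup (3 + 3 * m))).lowerCentralSeries (0 + 1)) →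
    ∃ ψ : SurfaceGroup (3 + 3 * m) ≃* SurfaceGroup (3 + 3 * m), (∀ i : Fin 3, (s4Kernels.stabilizeIter m i ⊔ (⊤ : Subgroup (SurfaceGroup (3 + 3 * m))).lowerCentralSeries (0 + 1)).map ψ.toMonoidHom = s4Kernels.stabilizeIter m i ⊔ (⊤ : Subgroup (SurfaceGroup (3 + 3 * m))).lowerCentralSeries (0 + 1)) ∧
      ∀ i : Fin 3, ∀ x ∈ Literature.Algebra.Lie.s4CutSystem m i, ψ (PresentedGroup.of x) ∈ K i ⊔ (⊤ : Subgroup (SurfaceGroup (3 + 3 * m))).lowerCentralSeries (0 + 1 + 1) :=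
  Summit.SmoothPoincare4.SmoothPoincare4.Theorems.NilpotentShadowsStandard.SaturatedTorsorDescent.stub_levelOneGlue
    Summit.SmoothPoincare4.SmoothPoincare4.Theorems.NilpotentShadowsStandard.SaturatedTorsorDescent.stub_johnsonGenerators
    Summit.SmoothPoincare4.SmoothPoincare4.Theorems.NilpotentShadowsStandard.SaturatedTorsorDescent.stub_magnusWittRead
    m

/-! ## Transport basics (adapted from Cruxes/NilpotentShadowsStandard/Lines/saturated_torsor_descent.lean) -/

/-- `γ` is characteristic. [folklore] -/
theorem map_γ (m c : ℕ) (ψ : SurfaceGroup (3 + 3 * m) ≃* SurfaceGroup (3 + 3 * m)) : ((⊤ : Subgroup (SurfaceGroup (3 + 3 * m))).lowerCentralSeries (c + 1)).map ψ.toMonoidHom = (⊤ : Subgroup (SurfaceGroup (3 + 3 * m))).lowerCentralSeries (c + 1) :=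
  Summit.SmoothPoincare4.SmoothPoincare4.Theorems.NilpotentShadowsStandard.Negative.map_lcs_top_equiv ψ _

/-- `γ` is antitone. [folklore] -/
theorem γ_succ_le (m c : ℕ) : (⊤ : Subgroup (SurfaceGroup (3 + 3 * m))).lowerCentralSeries (c + 1 + 1) ≤ (⊤ : Subgroup (SurfaceGroup (3 + 3 * m))).lowerCentralSeries (c + 1) :=
  Subgroup.lowerCentralSeries_antitone ⊤ (Nat.le_succ (c + 1))

/-- `(⊤ : Subgroup (SurfaceGroup (3 + 3 * m))).lowerCentralSeries (c + 1) ≤ γ₂`. [folklore] -/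
theorem γ_le_commutator (m c : ℕ) : (⊤ : Subgroup (SurfaceGroup (3 + 3 * m))).lowerCentralSeries (c + 1) ≤ (⊤ : Subgroup (SurfaceGroup (3 + 3 * m))).lowerCentralSeries 1 :=
  Subgroup.lowerCentralSeries_antitone ⊤ (Nat.succ_le_succ (Nat.zero_le c))

/-- `map` along a composite automorphism. [folklore] -/
theorem map_trans {m : ℕ} (e₁ e₂ : SurfaceGroup (3 + 3 * m) ≃* SurfaceGroup (3 + 3 * m)) (K : Subgroup (SurfaceGroup (3 + 3 * m))) :
    K.map (e₁.trans e₂).toMonoidHom = (K.map e₁.toMonoidHom).map e₂.toMonoidHom := by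
  rw [Subgroup.map_map]; rfl

/-- `ψ ∘ ψ⁻¹ = id` on subgroups. [folklore] -/
theorem map_symm_map {m : ℕ} (ψ : SurfaceGroup (3 + 3 * m) ≃* SurfaceGroup (3 + 3 * m)) (K : Subgroup (SurfaceGroup (3 + 3 * m))) :
    (K.map ψ.symm.toMonoidHom).map ψ.toMonoidHom = K := by
  ext x; simp

/-- `ψ⁻¹ ∘ ψ = id` on subgroups. [folklore] -/
theorem map_map_symm {m : ℕ} (ψ : SurfaceGroup (3 + 3 * m) ≃* SurfaceGroup (3 + 3 * m)) (K : Subgroup (SurfaceGroup (3 + 3 * m))) :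
    (K.map ψ.toMonoidHom).map ψ.symm.toMonoidHom = K := by
  ext x; simp

/-- Transport of a normal closure along an automorphism. [folklore] -/
theorem map_normalClosure_eq {m : ℕ} (α : SurfaceGroup (3 + 3 * m) ≃* SurfaceGroup (3 + 3 * m)) (s : Set (SurfaceGroup (3 + 3 * m))) :
    (normalClosure s).map α.toMonoidHom = normalClosure (α '' s) := by
  rw [Subgroup.map_normalClosure _ _ (by exact α.surjective)]
  rfl

/-- The image of a subgroup as a set. [folklore] -/
theorem image_coe_eq {m : ℕ} {α : SurfaceGroup (3 + 3 * m) ≃* SurfaceGroup (3 + 3 * m)} {K K' : Subgroup (SurfaceGroup (3 + 3 * m))}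
    (h : K.map α.toMonoidHom = K') : α '' (K : Set (SurfaceGroup (3 + 3 * m))) = (K' : Set (SurfaceGroup (3 + 3 * m))) := by
  rw [← h]; rfl

/-- Freeness of a normal-closure quotient is transported along an automorphism. [folklore] -/
theorem isFreeOfRank_transport {m k : ℕ} (α : SurfaceGroup (3 + 3 * m) ≃* SurfaceGroup (3 + 3 * m)) {s t : Set (SurfaceGroup (3 + 3 * m))} (h : α '' s = t)
    (hs : IsFreeOfRank (SurfaceGroup (3 + 3 * m) ⧸ normalClosure s) k) : IsFreeOfRank (SurfaceGroup (3 + 3 * m) ⧸ normalClosure t) k := by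
  refine hs.of_mulEquiv (QuotientGroup.congr (normalClosure s) (normalClosure t) α ?_)
  change (normalClosure s).map α.toMonoidHom = normalClosure t
  rw [map_normalClosure_eq, h]

/-- For normal `P`, `⟪P⟫ = P`. [folklore] -/
theorem isFreeOfRank_quotient_iff {m k : ℕ} (P : Subgroup (SurfaceGroup (3 + 3 * m))) [P.Normal] :
    IsFreeOfRank (SurfaceGroup (3 + 3 * m) ⧸ normalClosure (P : Set (SurfaceGroup (3 + 3 * m)))) k ↔ IsFreeOfRank (SurfaceGroup (3 + 3 * m) ⧸ P) k :=
  ⟨fun h => h.of_mulEquiv (QuotientGroup.quotientMulEquivOfEq (normalClosure_eq_self P)),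
    fun h => h.of_mulEquiv (QuotientGroup.quotientMulEquivOfEq (normalClosure_eq_self P).symm)⟩

/-- Iso-transport: if `ψ` standardises level `c` of `K`, then `ψ⁻¹K` is standard on the nose there.
[folklore] -/
theorem onTheNose_of_shadow {m c : ℕ} {K : TrisectionKernels (3 + 3 * m)} {ψ : SurfaceGroup (3 + 3 * m) ≃* SurfaceGroup (3 + 3 * m)}
    (hψ : ∀ i : Fin 3, (s4Kernels.stabilizeIter m i ⊔ (⊤ : Subgroup (SurfaceGroup (3 + 3 * m))).lowerCentralSeries (c + 1)).map ψ.toMonoidHom = K i ⊔ (⊤ : Subgroup (SurfaceGroup (3 + 3 * m))).lowerCentralSeries (c + 1)) (i : Fin 3) :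
    (K i).map ψ.symm.toMonoidHom ⊔ (⊤ : Subgroup (SurfaceGroup (3 + 3 * m))).lowerCentralSeries (c + 1) = s4Kernels.stabilizeIter m i ⊔ (⊤ : Subgroup (SurfaceGroup (3 + 3 * m))).lowerCentralSeries (c + 1) := by
  have h := congrArg (Subgroup.map ψ.symm.toMonoidHom) (hψ i)
  rw [map_map_symm, Subgroup.map_sup, map_γ] at h
  exact h.symm

/-- `⁅A ⊔ (⊤ : Subgroup (SurfaceGroup (3 + 3 * m))).lowerCentralSeries (c + 1), ⊤⁆ ≤ A` for a normal `A ⊇ γ m (c+1)`. [folklore] -/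
theorem commutator_sup_γ_le {m c : ℕ} (A : Subgroup (SurfaceGroup (3 + 3 * m))) [A.Normal] (hA : (⊤ : Subgroup (SurfaceGroup (3 + 3 * m))).lowerCentralSeries (c + 1 + 1) ≤ A) :
    ⁅A ⊔ (⊤ : Subgroup (SurfaceGroup (3 + 3 * m))).lowerCentralSeries (c + 1), (⊤ : Subgroup (SurfaceGroup (3 + 3 * m)))⁆ ≤ A := by
  rw [Subgroup.commutator_le]
  intro p hp q _
  obtain ⟨a, ha, z, hz, rfl⟩ := Subgroup.mem_sup_of_normal_left.1 hp
  have hzq : ⁅z, q⁆ ∈ A := hA (by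
    change ⁅z, q⁆ ∈ ⁅(⊤ : Subgroup (SurfaceGroup (3 + 3 * m))).lowerCentralSeries (c + 1), (⊤ : Subgroup (SurfaceGroup (3 + 3 * m)))⁆
    exact Subgroup.commutator_mem_commutator hz (Subgroup.mem_top q))
  have haq : ⁅a, q⁆ ∈ A := by
    have h2 := A.mul_mem ha (‹A.Normal›.conj_mem a⁻¹ (A.inv_mem ha) q)
    simpa [commutatorElement_def, mul_assoc] using h2
  have key : ⁅a * z, q⁆ = a * ⁅z, q⁆ * a⁻¹ * ⁅a, q⁆ := by
    simp only [commutatorElement_def]; group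
  rw [key]
  exact A.mul_mem (A.mul_mem (A.mul_mem ha hzq) (A.inv_mem ha)) haq

/-! ## Dictionary and level step (adapted from the 14594 skeleton; inputs = landed theorems) -/

/-- **THE DICTIONARY** (REACH data ⟹ the on-the-nose level step), from the landed
`stub_cutNormalForm` (`Nᵢ = ⟪Cᵢ⟫`) and `stub_noHiddenDepth` (`Kᵢ ∩ γ₂ ≤ [Kᵢ, S]` for honest `Kᵢ`).
[folklore] -/
theorem dictionary {m c : ℕ}
    (K : TrisectionKernels (3 + 3 * m)) (hn : ∀ i, (K i).Normal)
    (hfree : ∀ i, IsFreeOfRank (SurfaceGroup (3 + 3 * m) ⧸ normalClosure (K i : Set (SurfaceGroup (3 + 3 * m)))) (3 + 3 * m))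
    (hnose : ∀ i, K i ⊔ (⊤ : Subgroup (SurfaceGroup (3 + 3 * m))).lowerCentralSeries (c + 1) = s4Kernels.stabilizeIter m i ⊔ (⊤ : Subgroup (SurfaceGroup (3 + 3 * m))).lowerCentralSeries (c + 1)) (ψ : SurfaceGroup (3 + 3 * m) ≃* SurfaceGroup (3 + 3 * m))
    (hstab : ∀ i : Fin 3, (s4Kernels.stabilizeIter m i ⊔ (⊤ : Subgroup (SurfaceGroup (3 + 3 * m))).lowerCentralSeries (c + 1)).map ψ.toMonoidHom = s4Kernels.stabilizeIter m i ⊔ (⊤ : Subgroup (SurfaceGroup (3 + 3 * m))).lowerCentralSeries (c + 1))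
    (hcutIn : ∀ i : Fin 3, ∀ x ∈ Literature.Algebra.Lie.s4CutSystem m i, ψ (PresentedGroup.of x) ∈ K i ⊔ (⊤ : Subgroup (SurfaceGroup (3 + 3 * m))).lowerCentralSeries (c + 1 + 1)) (i : Fin 3) :
    (s4Kernels.stabilizeIter m i ⊔ (⊤ : Subgroup (SurfaceGroup (3 + 3 * m))).lowerCentralSeries (c + 1 + 1)).map ψ.toMonoidHom = K i ⊔ (⊤ : Subgroup (SurfaceGroup (3 + 3 * m))).lowerCentralSeries (c + 1 + 1) := by
  -- adapted from Cruxes/NilpotentShadowsStandard/Lines/saturated_torsor_descent.lean (`dictionary`)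
  have hcut := Summit.SmoothPoincare4.SmoothPoincare4.Theorems.NilpotentShadowsStandard.SaturatedTorsorDescent.stub_cutNormalForm
  have hnhd := @Summit.SmoothPoincare4.SmoothPoincare4.Theorems.NilpotentShadowsStandard.SaturatedTorsorDescent.stub_noHiddenDepth
  haveI := hn i
  haveI := (Summit.SmoothPoincare4.SmoothPoincare4.Theorems.ShadowsStandard.Negative.stabilizeIter_isGroupTrisection m).normal i
  haveI hAn : ((s4Kernels.stabilizeIter m i ⊔ (⊤ : Subgroup (SurfaceGroup (3 + 3 * m))).lowerCentralSeries (c + 1 + 1)).map ψ.toMonoidHom).Normal :=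
    Subgroup.Normal.map inferInstance _ ψ.surjective
  have hAeq : (s4Kernels.stabilizeIter m i ⊔ (⊤ : Subgroup (SurfaceGroup (3 + 3 * m))).lowerCentralSeries (c + 1 + 1)).map ψ.toMonoidHom = (s4Kernels.stabilizeIter m i).map ψ.toMonoidHom ⊔ (⊤ : Subgroup (SurfaceGroup (3 + 3 * m))).lowerCentralSeries (c + 1 + 1) := by
    rw [Subgroup.map_sup, map_γ]
  -- `≤`
  have hAB : (s4Kernels.stabilizeIter m i ⊔ (⊤ : Subgroup (SurfaceGroup (3 + 3 * m))).lowerCentralSeries (c + 1 + 1)).map ψ.toMonoidHom ≤ K i ⊔ (⊤ : Subgroup (SurfaceGroup (3 + 3 * m))).lowerCentralSeries (c + 1 + 1) := by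
    rw [hAeq]
    refine sup_le ?_ le_sup_right
    rw [show s4Kernels.stabilizeIter m i = normalClosure (PresentedGroup.of '' Literature.Algebra.Lie.s4CutSystem m i) from hcut m i, map_normalClosure_eq]
    refine Subgroup.normalClosure_le_normal ?_
    rintro _ ⟨_, ⟨x, hx, rfl⟩, rfl⟩
    exact hcutIn i x hx
  refine le_antisymm hAB ?_
  -- `≥`
  have hAγ : (s4Kernels.stabilizeIter m i ⊔ (⊤ : Subgroup (SurfaceGroup (3 + 3 * m))).lowerCentralSeries (c + 1 + 1)).map ψ.toMonoidHom ⊔ (⊤ : Subgroup (SurfaceGroup (3 + 3 * m))).lowerCentralSeries (c + 1) = K i ⊔ (⊤ : Subgroup (SurfaceGroup (3 + 3 * m))).lowerCentralSeries (c + 1) := by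
    have e : (s4Kernels.stabilizeIter m i).map ψ.toMonoidHom ⊔ (⊤ : Subgroup (SurfaceGroup (3 + 3 * m))).lowerCentralSeries (c + 1) = (s4Kernels.stabilizeIter m i ⊔ (⊤ : Subgroup (SurfaceGroup (3 + 3 * m))).lowerCentralSeries (c + 1)).map ψ.toMonoidHom := by
      rw [Subgroup.map_sup, map_γ]
    rw [hAeq, sup_assoc, sup_eq_right.2 (γ_succ_le m c), e, hstab i, hnose i]
  have hγ'A : (⊤ : Subgroup (SurfaceGroup (3 + 3 * m))).lowerCentralSeries (c + 1 + 1) ≤ (s4Kernels.stabilizeIter m i ⊔ (⊤ : Subgroup (SurfaceGroup (3 + 3 * m))).lowerCentralSeries (c + 1 + 1)).map ψ.toMonoidHom := by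
    rw [hAeq]; exact le_sup_right
  have hKγ : K i ⊓ (⊤ : Subgroup (SurfaceGroup (3 + 3 * m))).lowerCentralSeries (c + 1) ≤ (s4Kernels.stabilizeIter m i ⊔ (⊤ : Subgroup (SurfaceGroup (3 + 3 * m))).lowerCentralSeries (c + 1 + 1)).map ψ.toMonoidHom := by
    intro k hk
    have hk2 : k ∈ K i ⊓ (⊤ : Subgroup (SurfaceGroup (3 + 3 * m))).lowerCentralSeries 1 := ⟨hk.1, γ_le_commutator m c hk.2⟩
    have hfree' : IsFreeOfRank (SurfaceGroup (3 + 3 * m) ⧸ K i) (3 + 3 * m) := (isFreeOfRank_quotient_iff (K i)).1 (hfree i)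
    have hk3 : k ∈ ⁅K i, (⊤ : Subgroup (SurfaceGroup (3 + 3 * m)))⁆ := hnhd (3 + 3 * m) (3 + 3 * m) (K i) hfree' hk2
    have hle : ⁅K i, (⊤ : Subgroup (SurfaceGroup (3 + 3 * m)))⁆ ≤ (s4Kernels.stabilizeIter m i ⊔ (⊤ : Subgroup (SurfaceGroup (3 + 3 * m))).lowerCentralSeries (c + 1 + 1)).map ψ.toMonoidHom := by
      refine (Subgroup.commutator_mono (le_sup_left.trans (hAγ.symm.le)) le_rfl).trans ?_
      exact commutator_sup_γ_le _ hγ'A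
    exact hle hk3
  intro b hb
  have hb' : b ∈ (s4Kernels.stabilizeIter m i ⊔ (⊤ : Subgroup (SurfaceGroup (3 + 3 * m))).lowerCentralSeries (c + 1 + 1)).map ψ.toMonoidHom ⊔ (⊤ : Subgroup (SurfaceGroup (3 + 3 * m))).lowerCentralSeries (c + 1) := by
    rw [hAγ]
    exact (sup_le_sup_left (γ_succ_le m c) (K i)) hb
  obtain ⟨a, ha, z, hz, rfl⟩ := Subgroup.mem_sup_of_normal_left.1 hb'
  have hzB : z ∈ K i ⊔ (⊤ : Subgroup (SurfaceGroup (3 + 3 * m))).lowerCentralSeries (c + 1 + 1) := by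
    have := (K i ⊔ (⊤ : Subgroup (SurfaceGroup (3 + 3 * m))).lowerCentralSeries (c + 1 + 1)).mul_mem ((K i ⊔ (⊤ : Subgroup (SurfaceGroup (3 + 3 * m))).lowerCentralSeries (c + 1 + 1)).inv_mem (hAB ha)) hb
    simpa using this
  obtain ⟨k, hk, y, hy, rfl⟩ := Subgroup.mem_sup_of_normal_right.1 hzB
  have hkγ : k ∈ (⊤ : Subgroup (SurfaceGroup (3 + 3 * m))).lowerCentralSeries (c + 1) := by
    have := ((⊤ : Subgroup (SurfaceGroup (3 + 3 * m))).lowerCentralSeries (c + 1)).mul_mem hz (((⊤ : Subgroup (SurfaceGroup (3 + 3 * m))).lowerCentralSeries (c + 1)).inv_mem (γ_succ_le m c hy))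
    simpa using this
  exact Subgroup.mul_mem _ ha (Subgroup.mul_mem _ (hKγ ⟨hk, hkγ⟩) (hγ'A hy))

/-- **THE LEVEL STEP** from REACH at `(m, c)` (transport to on-the-nose, REACH, dictionary, compose).
[folklore] -/
theorem step {m c : ℕ}
    (hR : ∀ K : TrisectionKernels (3 + 3 * m), (∀ i, (K i).Normal) →
      (∀ i, IsFreeOfRank (SurfaceGroup (3 + 3 * m) ⧸ normalClosure (K i : Set (SurfaceGroup (3 + 3 * m)))) (3 + 3 * m)) →
      (∀ i j : Fin 3, i ≠ j → IsFreeOfRank (K.pairQuotient i j) (m + 1)) →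
      (∀ i, K i ⊔ (⊤ : Subgroup (SurfaceGroup (3 + 3 * m))).lowerCentralSeries (c + 1) = s4Kernels.stabilizeIter m i ⊔ (⊤ : Subgroup (SurfaceGroup (3 + 3 * m))).lowerCentralSeries (c + 1)) →
      ∃ ψ : SurfaceGroup (3 + 3 * m) ≃* SurfaceGroup (3 + 3 * m), (∀ i : Fin 3, (s4Kernels.stabilizeIter m i ⊔ (⊤ : Subgroup (SurfaceGroup (3 + 3 * m))).lowerCentralSeries (c + 1)).map ψ.toMonoidHom = s4Kernels.stabilizeIter m i ⊔ (⊤ : Subgroup (SurfaceGroup (3 + 3 * m))).lowerCentralSeries (c + 1)) ∧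
        ∀ i : Fin 3, ∀ x ∈ Literature.Algebra.Lie.s4CutSystem m i, ψ (PresentedGroup.of x) ∈ K i ⊔ (⊤ : Subgroup (SurfaceGroup (3 + 3 * m))).lowerCentralSeries (c + 1 + 1))
    (K : TrisectionKernels (3 + 3 * m)) (hn : ∀ i, (K i).Normal)
    (hfree : ∀ i, IsFreeOfRank (SurfaceGroup (3 + 3 * m) ⧸ normalClosure (K i : Set (SurfaceGroup (3 + 3 * m)))) (3 + 3 * m))
    (hpair : ∀ i j : Fin 3, i ≠ j → IsFreeOfRank (K.pairQuotient i j) (m + 1))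
    (hc : ∃ ψ : SurfaceGroup (3 + 3 * m) ≃* SurfaceGroup (3 + 3 * m), ∀ i : Fin 3, (s4Kernels.stabilizeIter m i ⊔ (⊤ : Subgroup (SurfaceGroup (3 + 3 * m))).lowerCentralSeries (c + 1)).map ψ.toMonoidHom = K i ⊔ (⊤ : Subgroup (SurfaceGroup (3 + 3 * m))).lowerCentralSeries (c + 1)) :
    ∃ ψ : SurfaceGroup (3 + 3 * m) ≃* SurfaceGroup (3 + 3 * m), ∀ i : Fin 3, (s4Kernels.stabilizeIter m i ⊔ (⊤ : Subgroup (SurfaceGroup (3 + 3 * m))).lowerCentralSeries (c + 1 + 1)).map ψ.toMonoidHom = K i ⊔ (⊤ : Subgroup (SurfaceGroup (3 + 3 * m))).lowerCentralSeries (c + 1 + 1) := by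
  -- adapted from Cruxes/NilpotentShadowsStandard/Lines/saturated_torsor_descent.lean (`step`)
  obtain ⟨ψ₀, hψ₀⟩ := hc
  set K' : TrisectionKernels (3 + 3 * m) := fun i => (K i).map ψ₀.symm.toMonoidHom with hK'
  have hn' : ∀ i, (K' i).Normal := fun i => Subgroup.Normal.map (hn i) _ ψ₀.symm.surjective
  have hnose : ∀ i, K' i ⊔ (⊤ : Subgroup (SurfaceGroup (3 + 3 * m))).lowerCentralSeries (c + 1) = s4Kernels.stabilizeIter m i ⊔ (⊤ : Subgroup (SurfaceGroup (3 + 3 * m))).lowerCentralSeries (c + 1) := fun i => onTheNose_of_shadow hψ₀ i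
  have hfree' : ∀ i, IsFreeOfRank (SurfaceGroup (3 + 3 * m) ⧸ normalClosure (K' i : Set (SurfaceGroup (3 + 3 * m)))) (3 + 3 * m) := fun i =>
    isFreeOfRank_transport ψ₀.symm (image_coe_eq rfl) (hfree i)
  have hpair' : ∀ i j : Fin 3, i ≠ j → IsFreeOfRank (TrisectionKernels.pairQuotient K' i j) (m + 1) := by
    intro i j hij
    refine isFreeOfRank_transport ψ₀.symm ?_ (hpair i j hij)
    rw [Set.image_union, image_coe_eq rfl, image_coe_eq rfl]
  obtain ⟨ψ, hstab, hcutIn⟩ := hR K' hn' hfree' hpair' hnose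
  have hdict : ∀ i, (s4Kernels.stabilizeIter m i ⊔ (⊤ : Subgroup (SurfaceGroup (3 + 3 * m))).lowerCentralSeries (c + 1 + 1)).map ψ.toMonoidHom = K' i ⊔ (⊤ : Subgroup (SurfaceGroup (3 + 3 * m))).lowerCentralSeries (c + 1 + 1) :=
    dictionary K' hn' hfree' hnose ψ hstab hcutIn
  refine ⟨ψ.trans ψ₀, fun i => ?_⟩
  rw [map_trans, hdict i, Subgroup.map_sup, map_γ, hK', map_symm_map]

end WildCentral

open WildCentral in
/-- **The `c = 1` rung of `NilpotentShadowsStandard` (item 14594), every `m`, sorry-free from the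
tree.** For every `(3+3m; m+1)` group trisection `K` of the trivial group some automorphism `ψ` of
`S = SurfaceGroup (3+3m)` satisfies `ψ(Nᵢ ⊔ γ₃S) = Kᵢ ⊔ γ₃S` for `i = 0,1,2`
(`γ₃S = (⊤ : Subgroup S).lowerCentralSeries 2`). Base: `abelianShadowStandard_proof` (14599);
step: `reach_zero` + `dictionary`. [folklore] -/
theorem nilpotentShadowsStandard_one (m : ℕ) (K : TrisectionKernels (3 + 3 * m))
    (hK : IsGroupTrisection (3 + 3 * m) (m + 1) (PUnit : Type) K) :
    ∃ ψ : SurfaceGroup (3 + 3 * m) ≃* SurfaceGroup (3 + 3 * m), ∀ i : Fin 3,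
      (s4Kernels.stabilizeIter m i ⊔
          (⊤ : Subgroup (SurfaceGroup (3 + 3 * m))).lowerCentralSeries 2).map ψ.toMonoidHom =
        K i ⊔ (⊤ : Subgroup (SurfaceGroup (3 + 3 * m))).lowerCentralSeries 2 :=
  step (reach_zero m) K hK.normal hK.free_quotient hK.free_pairQuotient
    (Summit.SmoothPoincare4.SmoothPoincare4.Theorems.AbelianShadowStandard.abelianShadowStandard_proof
      m K hK)

/-- **The class-two stratum is standard.** For every `(3+3m; m+1)` group trisection `K` of `{1}`
and every characteristic `M' ⊇ γ₃S` of `S = SurfaceGroup (3+3m)` (no finite-index hypothesis),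
`∃ ψ ∈ Aut S, ∀ i, ψ(Nᵢ ⊔ M') = Kᵢ ⊔ M'`. [folklore] -/
theorem classTwoLevels (m : ℕ) (K : TrisectionKernels (3 + 3 * m))
    (hK : IsGroupTrisection (3 + 3 * m) (m + 1) (PUnit : Type) K)
    (M' : Subgroup (SurfaceGroup (3 + 3 * m))) (hM' : M'.Characteristic)
    (hle : (⊤ : Subgroup (SurfaceGroup (3 + 3 * m))).lowerCentralSeries 2 ≤ M') :
    ∃ ψ : SurfaceGroup (3 + 3 * m) ≃* SurfaceGroup (3 + 3 * m), ∀ i : Fin 3,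
      (s4Kernels.stabilizeIter m i ⊔ M').map ψ.toMonoidHom = K i ⊔ M' := by
  obtain ⟨ψ, hψ⟩ := nilpotentShadowsStandard_one m K hK
  exact ⟨ψ, map_sup_eq_of_le_characteristic (s4Kernels.stabilizeIter m) K hle hM' ψ hψ⟩

/-- **REGISTERED STUB `stub_classTwoLevels`** (line `prym-layer-stable-rank`, crux
stmt-SmoothPoincare4-14593): the class-two stratum of `ShadowsStandard` — every characteristic level
`M ⊇ γ₃S` is standard for every `(3+3m; m+1)` group trisection of the trivial group. [folklore] -/
theorem stub_classTwoLevels :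
    ∀ (m : ℕ) (K : TrisectionKernels (3 + 3 * m)),
      IsGroupTrisection (3 + 3 * m) (m + 1) (PUnit : Type) K →
      ∀ M : Subgroup (SurfaceGroup (3 + 3 * m)), M.Characteristic →
      (⊤ : Subgroup (SurfaceGroup (3 + 3 * m))).lowerCentralSeries 2 ≤ M →
      ∃ ψ : SurfaceGroup (3 + 3 * m) ≃* SurfaceGroup (3 + 3 * m), ∀ i : Fin 3,
        (s4Kernels.stabilizeIter m i ⊔ M).map ψ.toMonoidHom = K i ⊔ M :=
  fun m K hK M hM hle => classTwoLevels m K hK M hM hle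

end Summit.SmoothPoincare4.SmoothPoincare4.Theorems.ShadowsStandard.PrymLayerStableRank

end
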